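import Mathlib.MeasureTheory.Group.LIntegral
import Mathlib.MeasureTheory.Measure.Prod
import Mathlib.MeasureTheory.Integral.Bochner.Basic
import Mathlib.MeasureTheory.Measure.Haar.OfBasis
import Mathlib.MeasureTheory.Function.L1Space.Integrable
import HarnessLib

/-!
# Sub-convolution vanishing: `g ≤ u ∗ g` with `∫ u < 1` forces `g = 0`

Elementary contraction lemmas on `(ℝ, dx)`:

* `lintegral_eq_zero_of_le_lintegral_sub`, `ae_eq_zero_of_le_lintegral_sub` (`ℝ≥0∞`-valued) and
  `ae_eq_zero_of_le_integral_sub` (real-valued): if `0 ≤ g ∈ L¹` satisfies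
  `g(x) ≤ ∫ u(x - y) g(y) dy` for a.e. `x`, with a kernel `u ≥ 0`, `∫ u < 1`, then `g = 0` a.e.
  (Tonelli and translation invariance give `∫ g ≤ (∫ u)(∫ g)`.)
* `measure_eq_of_le_of_univ_le`: a measure dominated by a finite measure of no larger total mass
  equals it; `measure_eq_withDensity_of_le`: a finite measure `ν` on `ℝ` with `ν ≤ σ dx`
  (`σ ≥ 0` integrable) and `∫ σ ≤ ν(ℝ)` is `σ dx`.

## Purpose

These are the two abstract steps of the contraction ("bootstrap") argument that identifies the
subsequential limits of the Lieb–Wu root distributions at half filling (module docstring of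
`Literature.MathematicalPhysics.QuantumLattice.LiebWuRho0Bounds`, steps 3–4): there the kernel is
Lieb–Wu's `Û` (`u = π⁻¹ fermiCos (U/2)`, `∫ u = 1/2`,
`Literature.Analysis.SpecialFunctions.FermiKernelPositivity`), `g` is `σ̃⁻` (the `Λ`-part) or
`(F - t)⁺ 1_{[-1,1]}` (the `k`-part), and the squeeze turns `ν ≤ σ̃⁺ dΛ`, `μ ≤ ρ̃⁺ dk` with matching
masses into equalities. It is the same mechanism as the positivity/uniqueness proof of Lieb–Wu,
Physica A 321 (2003) 1, §5, Theorem 1 (Neumann series of an operator of norm `1/2` with positive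
kernel).

## References

* E. H. Lieb, F. Y. Wu, Physica A 321 (2003) 1–27 = arXiv:cond-mat/0207529, §5, proof of
  Theorem 1 (`‖Û‖ = 1/2`, "`Û` has a positive kernel").
-/

noncomputable section

open MeasureTheory Set Filter
open scoped ENNReal Topology

namespace Literature.MeasureTheory.Lebesgue

/-- **Sub-convolution vanishing (ℝ≥0∞ form).** If `g ≤ u ∗ g` almost everywhere for a kernel
with `∫ u < 1` and `∫ g < ∞`, then `g = 0` almost everywhere. [folklore] -/
theorem lintegral_eq_zero_of_le_lintegral_sub {u g : ℝ → ℝ≥0∞} (hu : Measurable u) (hg : Measurable g)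
    (hU : ∫⁻ x, u x < 1) (hG : ∫⁻ x, g x ≠ ∞)
    (hdom : ∀ᵐ x, g x ≤ ∫⁻ y, u (x - y) * g y) : ∫⁻ x, g x = 0 := by
  -- `∫ g ≤ ∫∫ u(x-y) g(y) dy dx = (∫ u)(∫ g)`
  have hmeas : Measurable (Function.uncurry fun x y : ℝ => u (x - y) * g y) :=
    (hu.comp (measurable_fst.sub measurable_snd)).mul (hg.comp measurable_snd)
  have hle : ∫⁻ x, g x ≤ (∫⁻ x, u x) * ∫⁻ y, g y := by
    calc ∫⁻ x, g x ≤ ∫⁻ x, ∫⁻ y, u (x - y) * g y := lintegral_mono_ae hdom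
      _ = ∫⁻ y, ∫⁻ x, u (x - y) * g y := lintegral_lintegral_swap hmeas.aemeasurable
      _ = ∫⁻ y, (∫⁻ x, u x) * g y := by
          refine lintegral_congr fun y => ?_
          have hm : Measurable (fun x => u (x - y)) := hu.comp (measurable_sub_const y)
          rw [lintegral_mul_const _ hm, lintegral_sub_right_eq_self u y]
      _ = (∫⁻ x, u x) * ∫⁻ y, g y := by
          rw [lintegral_const_mul _ hg]
  -- hence `(1 - ∫u) ∫g ≤ 0`
  by_contra hne
  have hpos : 0 < ∫⁻ x, g x := pos_iff_ne_zero.2 hne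
  have : (∫⁻ y, g y) * (∫⁻ x, u x) < (∫⁻ y, g y) * 1 := ENNReal.mul_lt_mul_right hne hG hU
  rw [mul_one, mul_comm] at this
  exact absurd (hle.trans_lt this) (lt_irrefl _)

/-- A.e. form: under the same hypotheses, `g = 0` almost everywhere. [folklore] -/
theorem ae_eq_zero_of_le_lintegral_sub {u g : ℝ → ℝ≥0∞} (hu : Measurable u) (hg : Measurable g)
    (hU : ∫⁻ x, u x < 1) (hG : ∫⁻ x, g x ≠ ∞)
    (hdom : ∀ᵐ x, g x ≤ ∫⁻ y, u (x - y) * g y) : g =ᵐ[volume] 0 :=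
  (lintegral_eq_zero_iff hg).1 (lintegral_eq_zero_of_le_lintegral_sub hu hg hU hG hdom)

/-- **Sub-convolution vanishing (real form).** Let `u ≥ 0` be integrable with `∫ u < 1` and let
`g ≥ 0` be integrable with `g(x) ≤ ∫ u(x - y) g(y) dy` for a.e. `x`. Then `g = 0` a.e. [folklore] -/
theorem ae_eq_zero_of_le_integral_sub {u g : ℝ → ℝ} (hu : Measurable u) (hg : Measurable g)
    (hu0 : ∀ x, 0 ≤ u x) (hg0 : ∀ x, 0 ≤ g x) (hui : Integrable u) (hgi : Integrable g)
    (hU : ∫ x, u x < 1)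
    (hdom : ∀ᵐ x, g x ≤ ∫ y, u (x - y) * g y) : g =ᵐ[volume] 0 := by
  set U : ℝ → ℝ≥0∞ := fun x => ENNReal.ofReal (u x) with hUdef
  set Gf : ℝ → ℝ≥0∞ := fun x => ENNReal.ofReal (g x) with hGdef
  have hUm : Measurable U := ENNReal.measurable_ofReal.comp hu
  have hGm : Measurable Gf := ENNReal.measurable_ofReal.comp hg
  have hUint : ∫⁻ x, U x < 1 := by
    rw [hUdef, ← ofReal_integral_eq_lintegral_ofReal hui (Eventually.of_forall hu0)]
    exact ENNReal.ofReal_lt_one.2 hU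
  have hGint : ∫⁻ x, Gf x ≠ ∞ := by
    rw [hGdef, ← ofReal_integral_eq_lintegral_ofReal hgi (Eventually.of_forall hg0)]
    exact ENNReal.ofReal_ne_top
  have hdom' : ∀ᵐ x, Gf x ≤ ∫⁻ y, U (x - y) * Gf y := by
    filter_upwards [hdom] with x hx
    -- integrability of `y ↦ u(x-y) g(y)`? we only need `ofReal (∫ ...) ≤ ∫⁻ ofReal ...`
    have hnn : ∀ y, 0 ≤ u (x - y) * g y := fun y => mul_nonneg (hu0 _) (hg0 _)
    have hmeas : AEStronglyMeasurable (fun y => u (x - y) * g y) volume :=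
      ((hu.comp (measurable_const.sub measurable_id)).mul hg).aestronglyMeasurable
    calc Gf x = ENNReal.ofReal (g x) := rfl
      _ ≤ ENNReal.ofReal (∫ y, u (x - y) * g y) := ENNReal.ofReal_le_ofReal hx
      _ ≤ ∫⁻ y, ENNReal.ofReal (u (x - y) * g y) := by
          by_cases hint : Integrable (fun y => u (x - y) * g y)
          · rw [ofReal_integral_eq_lintegral_ofReal hint (Eventually.of_forall hnn)]
          · rw [integral_undef hint, ENNReal.ofReal_zero]; exact bot_le
      _ = ∫⁻ y, U (x - y) * Gf y := by
          refine lintegral_congr fun y => ?_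
          rw [hUdef, hGdef, ENNReal.ofReal_mul (hu0 _)]
  have h := ae_eq_zero_of_le_lintegral_sub hUm hGm hUint hGint hdom'
  filter_upwards [h] with x hx
  simp only [hGdef, Pi.zero_apply, ENNReal.ofReal_eq_zero] at hx
  exact le_antisymm hx (hg0 x)



/-- **Squeezing a dominated measure**: if `μ ≤ ν`, `ν` is finite and `ν(univ) ≤ μ(univ)`, then
`μ = ν`. [folklore] -/
theorem measure_eq_of_le_of_univ_le {α : Type*} [MeasurableSpace α] {μ ν : Measure α}
    [IsFiniteMeasure ν] (hle : μ ≤ ν) (huniv : ν Set.univ ≤ μ Set.univ) : μ = ν := by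
  haveI : IsFiniteMeasure μ := ⟨(hle Set.univ).trans_lt (measure_lt_top ν _)⟩
  ext A hA
  have h1 : μ A ≤ ν A := hle A
  have h2 : μ Aᶜ ≤ ν Aᶜ := hle Aᶜ
  have hμ := measure_add_measure_compl (μ := μ) hA
  have hν := measure_add_measure_compl (μ := ν) hA
  refine le_antisymm h1 ?_
  by_contra hlt
  rw [not_le] at hlt
  have : μ A + μ Aᶜ < ν A + ν Aᶜ :=
    ENNReal.add_lt_add_of_lt_of_le (measure_ne_top μ _) hlt h2
  rw [hμ, hν] at this
  exact absurd (huniv.trans_lt this) (lt_irrefl _)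

/-- **From domination by a density to equality.** If a finite measure `ν` on `ℝ` is dominated by
the measure with density `σ⁺` (`ν(A) ≤ ∫_A σ⁺`) and `ν(ℝ) = ∫ σ` with `σ ≥ 0` integrable, then
`ν` IS the measure with density `σ`. [folklore] -/
theorem measure_eq_withDensity_of_le {ν : Measure ℝ} [IsFiniteMeasure ν] {σ : ℝ → ℝ}
    (hσ0 : ∀ x, 0 ≤ σ x) (hσi : Integrable σ)
    (hle : ν ≤ volume.withDensity fun x => ENNReal.ofReal (σ x))
    (hmass : ENNReal.ofReal (∫ x, σ x) ≤ ν Set.univ) :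
    ν = volume.withDensity fun x => ENNReal.ofReal (σ x) := by
  haveI : IsFiniteMeasure (volume.withDensity fun x => ENNReal.ofReal (σ x)) := by
    refine ⟨?_⟩
    rw [withDensity_apply _ MeasurableSet.univ, Measure.restrict_univ,
      ← ofReal_integral_eq_lintegral_ofReal hσi (Eventually.of_forall hσ0)]
    exact ENNReal.ofReal_lt_top
  refine measure_eq_of_le_of_univ_le hle ?_
  rw [withDensity_apply _ MeasurableSet.univ, Measure.restrict_univ,
    ← ofReal_integral_eq_lintegral_ofReal hσi (Eventually.of_forall hσ0)]
  exact hmass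

end Literature.MeasureTheory.Lebesgue
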